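import Mathlib.RingTheory.MvPolynomial.Homogeneous
import Mathlib.Combinatorics.Nullstellensatz
import Mathlib.Analysis.Polynomial.CauchyBound
import Mathlib.Analysis.SpecialFunctions.Complex.Log
import Literature.NumberTheory.Transcendental.HypersurfaceCover
import Literature.FieldTheory.QuasiAlgClosed.Basic
import HarnessLib

/-!
# Analytic lemmas for Brownawell–Masser's exponential points: polynomials along rays

Auxiliary estimates for the proof of `Literature.NumberTheory.Transcendental.BrownawellMasser2017_dominantProjection`
(`ExpDominantSolvability.lean`; proof in `ExpDominantSolvabilityProofs.lean`), following the
Newton-approximation scheme of D. Masser as written up by D'Aquino–Fornasiero–Terzo,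
*Generic solutions of equations with iterated exponentials*, Trans. AMS 370 (2018), §2
(Lemma 2.3, Theorems 2.1 and 2.7): one looks for exponential points over `x = t v + ξ` with
`v ∈ (2πiℤ)ⁿ` generic, `t ∈ ℕ` large and `‖ξ‖ ≤ ρ t`.

* `Literature.NumberTheory.Transcendental.ExpDominant.eval_smul_near_top` — **leading-form asymptotics along a ray**
  (DFT Lemma 2.3): `a(t(v + ζ)) = t^{deg a} (a_top(v) + O(ε))` for `t ≥ t₀`, `‖ζ‖ ≤ ρ`.
* `Literature.NumberTheory.Transcendental.ExpDominant.exists_int_eval_ne_zero` — a non-zero polynomial does not vanish at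
  some point of `(2πiℤ)ⁿ` (DFT Lemma 2.3: "fix `q ∈ ℤⁿ` such that `Q_d(q) ≠ 0`").
* `Literature.NumberTheory.Transcendental.ExpDominant.norm_root_lt`, `Literature.NumberTheory.Transcendental.ExpDominant.lt_norm_root` — Cauchy's bound
  for the roots of a complex polynomial and of its reverse.
* `Literature.NumberTheory.Transcendental.ExpDominant.exists_root_bounds` — **polynomial growth of algebraic functions along a
  ray**: for `p ∈ ℂ[x][u]` with `p(·, 0) ≠ 0` and `v` generic for the leading forms of the
  extreme coefficients, every root `y` of `p(x, ·)`, `‖x - t v‖ ≤ ρ t`, `t ≥ t₀`, satisfies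
  `(K tᴺ)⁻¹ ≤ ‖y‖ ≤ K tᴺ` (the input "`fᵢ(ω) = t^{dᵢ}(cᵢ + o(1))`, `aᵢ = O(log t)`" of DFT Thm 2.7).

## References

* P. D'Aquino, A. Fornasiero, G. Terzo, *Generic solutions of equations with iterated
  exponentials*, Trans. Amer. Math. Soc. 370 (2018), 1393–1407, §2.
* W. D. Brownawell, D. W. Masser, *Zero estimates with moving targets*, J. Lond. Math. Soc. (2)
  95 (2017), 441–454, Prop. 2.
-/

noncomputable section

open MvPolynomial Filter Topology Set Metric

namespace Literature.NumberTheory.Transcendental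

namespace ExpDominant

variable {n : ℕ}

/-! ### Leading-form asymptotics along a ray -/

/-- **Leading-form asymptotics along a ray** (D'Aquino–Fornasiero–Terzo 2018, Lemma 2.3 and the
estimate `fᵢ(t v) = t^{dᵢ}(cᵢ + o(1))` in the proof of Thm 2.7, polynomial case). For
`a ∈ ℂ[x₁, …, xₙ]` of total degree `D` with leading form `a_D` and any `v`, `ε > 0`: there are
`ρ > 0` and `t₀ ≥ 1` with `‖a(t(v + ζ)) - t^D a_D(v)‖ ≤ ε t^D` whenever `t ≥ t₀` and `‖ζ‖ ≤ ρ`.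
[cite: DaquinoFornasieroTerzo2017, Lemma 2.3] -/
theorem eval_smul_near_top (a : MvPolynomial (Fin n) ℂ) (v : Fin n → ℂ) {ε : ℝ} (hε : 0 < ε) :
    ∃ ρ : ℝ, 0 < ρ ∧ ∃ t₀ : ℝ, 1 ≤ t₀ ∧ ∀ t : ℝ, t₀ ≤ t → ∀ ζ : Fin n → ℂ, ‖ζ‖ ≤ ρ →
      ‖eval ((t : ℂ) • (v + ζ)) a -
          (t : ℂ) ^ a.totalDegree * eval v (homogeneousComponent a.totalDegree a)‖ ≤
        ε * t ^ a.totalDegree := by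
  set D := a.totalDegree with hD
  have hcont : ContinuousAt (fun w : Fin n → ℂ => eval w (homogeneousComponent D a)) v :=
    (MvPolynomial.continuous_eval _).continuousAt
  obtain ⟨δ, hδ, hδε⟩ := Metric.continuousAt_iff.mp hcont (ε / 2) (half_pos hε)
  have hB : ∀ i : ℕ, ∃ B : ℝ, 0 ≤ B ∧ ∀ ζ : Fin n → ℂ, ‖ζ‖ ≤ 1 →
      ‖eval (v + ζ) (homogeneousComponent i a)‖ ≤ B := by
    intro i
    obtain ⟨C, hC, N, hCN⟩ := HypersurfaceCover.exists_norm_eval_le_pow (homogeneousComponent i a)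
    refine ⟨C * (2 + ‖v‖) ^ N, by positivity, fun ζ hζ => (hCN (v + ζ)).trans ?_⟩
    have hle : 1 + ‖v + ζ‖ ≤ 2 + ‖v‖ := by
      have := norm_add_le v ζ
      linarith
    exact mul_le_mul_of_nonneg_left (pow_le_pow_left₀ (by positivity) hle N) hC
  choose B hB0 hBle using hB
  set SB := ∑ i ∈ Finset.range D, B i with hSB
  have hSB0 : 0 ≤ SB := Finset.sum_nonneg fun i _ => hB0 i
  refine ⟨min (δ / 2) 1, by positivity, max 1 (2 * SB / ε + 1), le_max_left _ _, ?_⟩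
  intro t ht ζ hζ
  have ht1 : 1 ≤ t := le_trans (le_max_left _ _) ht
  have ht0 : 0 < t := by linarith
  have hζδ : ‖ζ‖ ≤ δ / 2 := hζ.trans (min_le_left _ _)
  have hζ1 : ‖ζ‖ ≤ 1 := hζ.trans (min_le_right _ _)
  have hdecomp : eval ((t : ℂ) • (v + ζ)) a =
      ∑ i ∈ Finset.range (D + 1), (t : ℂ) ^ i * eval (v + ζ) (homogeneousComponent i a) := by
    conv_lhs => rw [← sum_homogeneousComponent a]
    rw [map_sum]
    refine Finset.sum_congr rfl fun i _ => ?_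
    exact MvPolynomial.IsHomogeneous.eval_smul_eq (homogeneousComponent_isHomogeneous i a) _ _
  rw [hdecomp, Finset.sum_range_succ, add_sub_assoc]
  have h1 : ‖(t : ℂ) ^ D * eval (v + ζ) (homogeneousComponent D a) -
      (t : ℂ) ^ D * eval v (homogeneousComponent D a)‖ ≤ ε / 2 * t ^ D := by
    rw [← mul_sub, norm_mul, norm_pow, Complex.norm_real, Real.norm_of_nonneg ht0.le, mul_comm]
    gcongr
    have hdist : dist (v + ζ) v < δ := by
      rw [dist_eq_norm, add_sub_cancel_left]; linarith
    have := hδε hdist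
    rw [dist_eq_norm] at this
    exact this.le
  have h2 : ‖∑ i ∈ Finset.range D, (t : ℂ) ^ i * eval (v + ζ) (homogeneousComponent i a)‖ ≤
      ε / 2 * t ^ D := by
    rcases Nat.eq_zero_or_pos D with hD0 | hDpos
    · rw [hD0]; simp; positivity
    · obtain ⟨D', hD'⟩ : ∃ D', D = D' + 1 := ⟨D - 1, by omega⟩
      have hSBt : SB ≤ ε / 2 * t := by
        have h := le_trans (le_max_right _ _) ht
        have h' : ε / 2 * (2 * SB / ε + 1) ≤ ε / 2 * t :=
          mul_le_mul_of_nonneg_left h (half_pos hε).le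
        have e : ε / 2 * (2 * SB / ε + 1) = SB + ε / 2 := by field_simp
        linarith
      calc ‖∑ i ∈ Finset.range D, (t : ℂ) ^ i * eval (v + ζ) (homogeneousComponent i a)‖
          ≤ ∑ i ∈ Finset.range D, ‖(t : ℂ) ^ i * eval (v + ζ) (homogeneousComponent i a)‖ :=
            norm_sum_le _ _
        _ ≤ ∑ i ∈ Finset.range D, t ^ D' * B i := by
            refine Finset.sum_le_sum fun i hi => ?_
            rw [norm_mul, norm_pow, Complex.norm_real, Real.norm_of_nonneg ht0.le]
            have hi' : i ≤ D' := by have := Finset.mem_range.mp hi; omega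
            exact mul_le_mul (pow_le_pow_right₀ ht1 hi') (hBle i ζ hζ1) (norm_nonneg _)
              (pow_nonneg ht0.le _)
        _ = t ^ D' * SB := by rw [hSB, Finset.mul_sum]
        _ ≤ t ^ D' * (ε / 2 * t) := by gcongr
        _ = ε / 2 * t ^ D := by rw [hD', pow_succ]; ring
  calc _ ≤ ‖∑ i ∈ Finset.range D, (t : ℂ) ^ i * eval (v + ζ) (homogeneousComponent i a)‖ +
        ‖(t : ℂ) ^ D * eval (v + ζ) (homogeneousComponent D a) -
          (t : ℂ) ^ D * eval v (homogeneousComponent D a)‖ := norm_add_le _ _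
    _ ≤ ε / 2 * t ^ D + ε / 2 * t ^ D := add_le_add h2 h1
    _ = ε * t ^ D := by ring

/-- The leading form of a non-zero polynomial is non-zero. [folklore] -/
theorem homogeneousComponent_totalDegree_ne_zero {σ : Type*} {R : Type*} [CommSemiring R]
    {a : MvPolynomial σ R} (ha : a ≠ 0) :
    homogeneousComponent a.totalDegree a ≠ 0 := by
  classical
  obtain ⟨d, hd, hdeg⟩ : ∃ d ∈ a.support, d.degree = a.totalDegree := by
    have hne : a.support.Nonempty := support_nonempty.mpr ha
    obtain ⟨d, hd, hmax⟩ := Finset.exists_max_image a.support (fun d => d.degree) hne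
    refine ⟨d, hd, le_antisymm (le_totalDegree hd) ?_⟩
    rw [totalDegree]
    exact Finset.sup_le fun e he => hmax e he
  intro h
  have := congrArg (coeff d) h
  rw [coeff_homogeneousComponent, if_pos hdeg, coeff_zero] at this
  exact (mem_support_iff.mp hd) this

/-! ### Generic lattice directions -/

/-- **A non-zero polynomial does not vanish identically on `(2πiℤ)ⁿ`** (D'Aquino–Fornasiero–Terzo
2018, Lemma 2.3: "fix `q̄ ∈ ℤⁿ` such that `Q_d(q̄) ≠ 0`"; here via Alon's lemma, Mathlib
`MvPolynomial.eq_zero_of_eval_zero_at_prod_finset`). [cite: DaquinoFornasieroTerzo2017, Lemma 2.3] -/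
theorem exists_int_eval_ne_zero (Q : MvPolynomial (Fin n) ℂ) (hQ : Q ≠ 0) :
    ∃ q : Fin n → ℤ, eval (fun i => 2 * Real.pi * Complex.I * (q i : ℂ)) Q ≠ 0 := by
  classical
  by_contra h
  push Not at h
  apply hQ
  have h2 : (2 * Real.pi * Complex.I : ℂ) ≠ 0 := by simp [Real.pi_ne_zero, Complex.I_ne_zero]
  refine eq_zero_of_eval_zero_at_prod_finset Q
    (fun i => (Finset.range (Q.degreeOf i + 1)).image
      (fun m : ℕ => 2 * Real.pi * Complex.I * (m : ℂ))) ?_ ?_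
  · intro i
    rw [Finset.card_image_of_injective _ ?_]
    · simp
    · intro m m' hmm'
      have := mul_left_cancel₀ h2 hmm'
      exact_mod_cast this
  · intro x hx
    choose m _hm hxm using fun i => Finset.mem_image.mp (hx i)
    have hx' : x = fun i => 2 * Real.pi * Complex.I * ((m i : ℤ) : ℂ) := by
      funext i; rw [← hxm i]; push_cast; ring
    rw [hx']
    exact h _

/-! ### Cauchy's bound, upper and lower -/

/-- Cauchy's bound: a root `y` of `p ≠ 0` has `‖y‖ < (Σₖ ‖pₖ‖) / ‖lc p‖ + 1` (Mathlib
`Polynomial.IsRoot.norm_lt_cauchyBound`). [folklore] -/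
theorem norm_root_lt {p : Polynomial ℂ} (hp : p ≠ 0) {y : ℂ} (hy : p.IsRoot y) :
    ‖y‖ < (∑ k ∈ Finset.range (p.natDegree + 1), ‖p.coeff k‖) / ‖p.leadingCoeff‖ + 1 := by
  have h := Polynomial.IsRoot.norm_lt_cauchyBound hp hy
  rw [Polynomial.cauchyBound] at h
  have hlc : ‖p.leadingCoeff‖₊ ≠ 0 := by
    rw [ne_eq, nnnorm_eq_zero, Polynomial.leadingCoeff_eq_zero]; exact hp
  have hsup : (Finset.range p.natDegree).sup (fun i => ‖p.coeff i‖₊) ≤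
      ∑ i ∈ Finset.range (p.natDegree + 1), ‖p.coeff i‖₊ :=
    Finset.sup_le fun i hi =>
      Finset.single_le_sum (f := fun j => ‖p.coeff j‖₊) (fun _ _ => zero_le)
        (Finset.mem_range.mpr (Nat.lt_succ_of_lt (Finset.mem_range.mp hi)))
  have h' : (‖y‖₊ : ℝ) <
      (∑ i ∈ Finset.range (p.natDegree + 1), (‖p.coeff i‖₊ : ℝ)) / ‖p.leadingCoeff‖₊ + 1 := by
    have h1 : ‖y‖₊ < (∑ i ∈ Finset.range (p.natDegree + 1), ‖p.coeff i‖₊) / ‖p.leadingCoeff‖₊ + 1 :=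
      h.trans_le (add_le_add (div_le_div_of_nonneg_right hsup zero_le) le_rfl)
    exact_mod_cast h1
  simpa using h'

/-- Cauchy's bound for the reverse polynomial: if `p(0) ≠ 0`, a root `y` of `p` has
`(Σₖ ‖pₖ‖ / ‖p₀‖ + 1)⁻¹ < ‖y‖`. [folklore] -/
theorem lt_norm_root {p : Polynomial ℂ} (h0 : p.coeff 0 ≠ 0) {y : ℂ} (hy : p.IsRoot y) :
    ((∑ k ∈ Finset.range (p.natDegree + 1), ‖p.coeff k‖) / ‖p.coeff 0‖ + 1)⁻¹ < ‖y‖ := by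
  have hp : p ≠ 0 := fun h => h0 (by simp [h])
  have hy0 : y ≠ 0 := by
    rintro rfl
    exact h0 (by simpa [Polynomial.coeff_zero_eq_eval_zero] using hy)
  letI : Invertible y := invertibleOfNonzero hy0
  have hrev : p.reverse.IsRoot (⅟y) := by
    have := (Polynomial.eval₂_reverse_eq_zero_iff (RingHom.id ℂ) y p).mpr
      (by simpa [Polynomial.eval₂_id] using hy)
    simpa [Polynomial.IsRoot, Polynomial.eval₂_id] using this
  have hrev0 : p.reverse ≠ 0 := by rwa [ne_eq, Polynomial.reverse_eq_zero]
  have hlt := norm_root_lt hrev0 hrev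
  have hlc : p.reverse.leadingCoeff = p.coeff 0 := by
    rw [Polynomial.reverse_leadingCoeff, Polynomial.trailingCoeff,
      Polynomial.natTrailingDegree_eq_zero.mpr (Or.inr h0)]
  set N := p.natDegree with hN
  have hsum : ∑ k ∈ Finset.range (p.reverse.natDegree + 1), ‖p.reverse.coeff k‖ ≤
      ∑ k ∈ Finset.range (N + 1), ‖p.coeff k‖ := by
    have hdeg : p.reverse.natDegree ≤ N := Polynomial.reverse_natDegree_le p
    calc ∑ k ∈ Finset.range (p.reverse.natDegree + 1), ‖p.reverse.coeff k‖
        ≤ ∑ k ∈ Finset.range (N + 1), ‖p.reverse.coeff k‖ :=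
          Finset.sum_le_sum_of_subset_of_nonneg (Finset.range_mono (by omega))
            (fun _ _ _ => norm_nonneg _)
      _ = ∑ k ∈ Finset.range (N + 1), ‖p.coeff (N - k)‖ := by
          refine Finset.sum_congr rfl fun k hk => ?_
          rw [Polynomial.coeff_reverse, Polynomial.revAt_le (by have := Finset.mem_range.mp hk; omega)]
      _ = ∑ k ∈ Finset.range (N + 1), ‖p.coeff k‖ := by
          have := Finset.sum_range_reflect (fun j => ‖p.coeff j‖) (N + 1)
          simpa using this
  have hB : ‖y‖⁻¹ < (∑ k ∈ Finset.range (N + 1), ‖p.coeff k‖) / ‖p.coeff 0‖ + 1 := by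
    have e : ‖⅟y‖ = ‖y‖⁻¹ := by rw [invOf_eq_inv, norm_inv]
    rw [← e]
    refine hlt.trans_le ?_
    rw [hlc]
    gcongr
  have hpos : 0 < (∑ k ∈ Finset.range (N + 1), ‖p.coeff k‖) / ‖p.coeff 0‖ + 1 := by positivity
  exact (inv_lt_comm₀ (norm_pos_iff.mpr hy0) hpos).mp hB

/-! ### Polynomial growth of the roots of `p(x, ·)` along a ray -/

/-- **Algebraic functions have polynomial growth and decay along a generic ray** (the estimates
`|fᵢ(ω)| ≥ c(1 + |ω|)^{dᵢ}`, `aᵢ = O(log t)` in D'Aquino–Fornasiero–Terzo 2018, proof of Thm 2.7,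
here for all roots at once). Let `p ∈ ℂ[x₁, …, xₙ][u]` and let `v` be a direction at which the
leading forms of the constant coefficient `p₀` and of the leading coefficient `p_d` do not vanish.
Then there are `ρ > 0`, `t₀ ≥ 1`, `K ≥ 1`, `N` such that for `t ≥ t₀` and `‖x - t v‖ ≤ ρ t`:
`p₀(x) ≠ 0`, `p_d(x) ≠ 0`, and every root `y` of `p(x, ·)` satisfies
`(K tᴺ)⁻¹ ≤ ‖y‖ ≤ K tᴺ`. [cite: DaquinoFornasieroTerzo2017, Thm 2.7 (proof)] -/
theorem exists_root_bounds (p : Polynomial (MvPolynomial (Fin n) ℂ)) (v : Fin n → ℂ)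
    (h0 : eval v (homogeneousComponent (p.coeff 0).totalDegree (p.coeff 0)) ≠ 0)
    (hd : eval v (homogeneousComponent p.leadingCoeff.totalDegree p.leadingCoeff) ≠ 0) :
    ∃ ρ : ℝ, 0 < ρ ∧ ∃ t₀ : ℝ, 1 ≤ t₀ ∧ ∃ K : ℝ, 1 ≤ K ∧ ∃ N : ℕ,
      ∀ t : ℝ, t₀ ≤ t → ∀ x : Fin n → ℂ, ‖x - (t : ℂ) • v‖ ≤ ρ * t →
        (eval x (p.coeff 0) ≠ 0 ∧ eval x p.leadingCoeff ≠ 0) ∧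
        ∀ y : ℂ, (HypersurfaceCover.spec p x).IsRoot y →
          ‖y‖ ≤ K * t ^ N ∧ (K * t ^ N)⁻¹ ≤ ‖y‖ := by
  -- the two extreme coefficients along the ray
  set a₀ := p.coeff 0 with ha₀
  set a₁ := p.leadingCoeff with ha₁
  set α₀ := eval v (homogeneousComponent a₀.totalDegree a₀) with hα₀
  set α₁ := eval v (homogeneousComponent a₁.totalDegree a₁) with hα₁
  have hα₀pos : 0 < ‖α₀‖ := norm_pos_iff.mpr h0
  have hα₁pos : 0 < ‖α₁‖ := norm_pos_iff.mpr hd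
  obtain ⟨ρ₀, hρ₀, t₀, ht₀, H₀⟩ := eval_smul_near_top a₀ v (half_pos hα₀pos)
  obtain ⟨ρ₁, hρ₁, t₁, ht₁, H₁⟩ := eval_smul_near_top a₁ v (half_pos hα₁pos)
  -- uniform polynomial bounds for all coefficients
  have hC : ∀ k : ℕ, ∃ C : ℝ, 0 ≤ C ∧ ∃ D : ℕ, ∀ z : Fin n → ℂ,
      ‖eval z (p.coeff k)‖ ≤ C * (1 + ‖z‖) ^ D := fun k =>
    HypersurfaceCover.exists_norm_eval_le_pow (p.coeff k)
  choose C hC0 D hCD using hC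
  set d := p.natDegree with hdnat
  set Csum := ∑ k ∈ Finset.range (d + 1), C k with hCsum
  set Dmax := (Finset.range (d + 1)).sup D with hDmax
  have hCsum0 : 0 ≤ Csum := Finset.sum_nonneg fun k _ => hC0 k
  set ρ := min ρ₀ ρ₁ with hρ
  have hρpos : 0 < ρ := lt_min hρ₀ hρ₁
  set C' := Csum * (1 + ‖v‖ + ρ) ^ Dmax with hC'
  have hC'0 : 0 ≤ C' := by positivity
  set K := max (2 * C' / ‖α₁‖ + 1) (2 * C' / ‖α₀‖ + 1) with hK
  have hK1 : 1 ≤ K := by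
    have h : (0 : ℝ) ≤ 2 * C' / ‖α₁‖ := by positivity
    exact le_max_of_le_left (by linarith)
  refine ⟨ρ, hρpos, max t₀ t₁, le_max_of_le_left ht₀, K, hK1, Dmax, ?_⟩
  intro t ht x hx
  have ht1 : 1 ≤ t := ht₀.trans ((le_max_left _ _).trans ht)
  have htpos : 0 < t := by linarith
  -- write `x = t • (v + ζ)` with `‖ζ‖ ≤ ρ`
  set ζ : Fin n → ℂ := (t : ℂ)⁻¹ • (x - (t : ℂ) • v) with hζ
  have htC : (t : ℂ) ≠ 0 := by exact_mod_cast htpos.ne'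
  have hxζ : x = (t : ℂ) • (v + ζ) := by
    rw [hζ, smul_add, smul_inv_smul₀ htC, add_sub_cancel]
  have hζle : ‖ζ‖ ≤ ρ := by
    rw [hζ, norm_smul, norm_inv, Complex.norm_real, Real.norm_of_nonneg htpos.le]
    rw [inv_mul_le_iff₀ htpos]
    linarith [mul_comm ρ t]
  -- lower bounds for the two extreme coefficients
  have hlow : ∀ {a : MvPolynomial (Fin n) ℂ} {α : ℂ}, α = eval v (homogeneousComponent a.totalDegree a) →
      ‖eval ((t : ℂ) • (v + ζ)) a - (t : ℂ) ^ a.totalDegree * α‖ ≤ ‖α‖ / 2 * t ^ a.totalDegree →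
      ‖α‖ / 2 ≤ ‖eval x a‖ := by
    intro a α hαdef hle
    have htD : (1 : ℝ) ≤ t ^ a.totalDegree := one_le_pow₀ ht1
    have hnorm : ‖(t : ℂ) ^ a.totalDegree * α‖ = t ^ a.totalDegree * ‖α‖ := by
      rw [norm_mul, norm_pow, Complex.norm_real, Real.norm_of_nonneg htpos.le]
    rw [hxζ]
    have h1 := norm_sub_norm_le ((t : ℂ) ^ a.totalDegree * α) (eval ((t : ℂ) • (v + ζ)) a)
    rw [norm_sub_rev] at hle
    have h2 : t ^ a.totalDegree * ‖α‖ - ‖α‖ / 2 * t ^ a.totalDegree ≤ ‖eval ((t : ℂ) • (v + ζ)) a‖ := by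
      linarith [hnorm]
    have h3 : ‖α‖ / 2 ≤ t ^ a.totalDegree * ‖α‖ - ‖α‖ / 2 * t ^ a.totalDegree := by
      nlinarith [norm_nonneg α]
    exact h3.trans h2
  have hlow₀ : ‖α₀‖ / 2 ≤ ‖eval x a₀‖ :=
    hlow hα₀ (H₀ t ((le_max_left _ _).trans ht) ζ (hζle.trans (min_le_left _ _)))
  have hlow₁ : ‖α₁‖ / 2 ≤ ‖eval x a₁‖ :=
    hlow hα₁ (H₁ t ((le_max_right _ _).trans ht) ζ (hζle.trans (min_le_right _ _)))
  have hx0 : eval x a₀ ≠ 0 := fun h => by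
    rw [h, norm_zero] at hlow₀; linarith
  have hx1 : eval x a₁ ≠ 0 := fun h => by
    rw [h, norm_zero] at hlow₁; linarith
  refine ⟨⟨hx0, hx1⟩, fun y hy => ?_⟩
  -- the specialised polynomial
  have hp0 : p ≠ 0 := by
    rintro rfl
    apply h0
    rw [hα₀]
    simp [ha₀]
  have hspec_lc : (HypersurfaceCover.spec p x).leadingCoeff = eval x a₁ :=
    Polynomial.leadingCoeff_map_of_leadingCoeff_ne_zero _ hx1
  have hspec_deg : (HypersurfaceCover.spec p x).natDegree = d :=
    Polynomial.natDegree_map_of_leadingCoeff_ne_zero _ hx1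
  have hspec_ne : HypersurfaceCover.spec p x ≠ 0 := fun h => by
    rw [h, Polynomial.leadingCoeff_zero] at hspec_lc; exact hx1 hspec_lc.symm
  have hspec_coeff : ∀ k, (HypersurfaceCover.spec p x).coeff k = eval x (p.coeff k) := fun k =>
    Polynomial.coeff_map _ _
  -- bound on the sum of coefficient norms
  have hxnorm : 1 + ‖x‖ ≤ t * (1 + ‖v‖ + ρ) := by
    rw [hxζ, norm_smul, Complex.norm_real, Real.norm_of_nonneg htpos.le]
    have := norm_add_le v ζ
    nlinarith [norm_nonneg v, norm_nonneg ζ]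
  have hA : ∑ k ∈ Finset.range (d + 1), ‖(HypersurfaceCover.spec p x).coeff k‖ ≤ C' * t ^ Dmax := by
    calc ∑ k ∈ Finset.range (d + 1), ‖(HypersurfaceCover.spec p x).coeff k‖
        ≤ ∑ k ∈ Finset.range (d + 1), C k * (t * (1 + ‖v‖ + ρ)) ^ Dmax := by
          refine Finset.sum_le_sum fun k hk => ?_
          rw [hspec_coeff]
          refine (hCD k x).trans ?_
          refine mul_le_mul_of_nonneg_left ?_ (hC0 k)
          calc (1 + ‖x‖) ^ D k ≤ (t * (1 + ‖v‖ + ρ)) ^ D k :=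
                pow_le_pow_left₀ (by positivity) hxnorm _
            _ ≤ (t * (1 + ‖v‖ + ρ)) ^ Dmax := by
                refine pow_le_pow_right₀ ?_ (Finset.le_sup hk)
                have : 1 ≤ 1 + ‖v‖ + ρ := by linarith [norm_nonneg v]
                nlinarith
      _ = C' * t ^ Dmax := by rw [← Finset.sum_mul, hC', mul_pow]; ring
  have htD : (1 : ℝ) ≤ t ^ Dmax := one_le_pow₀ ht1
  constructor
  · -- upper bound
    have hlt := norm_root_lt hspec_ne hy
    rw [hspec_deg, hspec_lc] at hlt
    have h1 : (∑ k ∈ Finset.range (d + 1), ‖(HypersurfaceCover.spec p x).coeff k‖) / ‖eval x a₁‖ ≤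
        C' * t ^ Dmax / (‖α₁‖ / 2) :=
      div_le_div₀ (by positivity) hA (by positivity) hlow₁
    have h2 : C' * t ^ Dmax / (‖α₁‖ / 2) + 1 ≤ K * t ^ Dmax := by
      calc C' * t ^ Dmax / (‖α₁‖ / 2) + 1 = 2 * C' / ‖α₁‖ * t ^ Dmax + 1 := by ring
        _ ≤ 2 * C' / ‖α₁‖ * t ^ Dmax + t ^ Dmax := by linarith
        _ = (2 * C' / ‖α₁‖ + 1) * t ^ Dmax := by ring
        _ ≤ K * t ^ Dmax := by gcongr; exact le_max_left _ _
    linarith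
  · -- lower bound
    have h00 : (HypersurfaceCover.spec p x).coeff 0 ≠ 0 := by rwa [hspec_coeff]
    have hlt := lt_norm_root h00 hy
    rw [hspec_deg, hspec_coeff] at hlt
    have h1 : (∑ k ∈ Finset.range (d + 1), ‖(HypersurfaceCover.spec p x).coeff k‖) / ‖eval x a₀‖ + 1 ≤
        K * t ^ Dmax := by
      have h1 : (∑ k ∈ Finset.range (d + 1), ‖(HypersurfaceCover.spec p x).coeff k‖) / ‖eval x a₀‖ ≤
          C' * t ^ Dmax / (‖α₀‖ / 2) :=
        div_le_div₀ (by positivity) hA (by positivity) hlow₀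
      calc _ ≤ C' * t ^ Dmax / (‖α₀‖ / 2) + 1 := by linarith
        _ = 2 * C' / ‖α₀‖ * t ^ Dmax + 1 := by ring
        _ ≤ 2 * C' / ‖α₀‖ * t ^ Dmax + t ^ Dmax := by linarith
        _ = (2 * C' / ‖α₀‖ + 1) * t ^ Dmax := by ring
        _ ≤ K * t ^ Dmax := by gcongr; exact le_max_right _ _
    have hpos : 0 < (∑ k ∈ Finset.range (d + 1), ‖(HypersurfaceCover.spec p x).coeff k‖) /
        ‖eval x a₀‖ + 1 := by positivity
    exact ((inv_anti₀ hpos h1).trans hlt.le)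

end ExpDominant

end Literature.NumberTheory.Transcendental
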